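import Summits.KontsevichZagierPeriods.KontsevichZagierPeriods.Theses.ScissorsAvatars
import Summits.KontsevichZagierPeriods.KontsevichZagierPeriods.Theses.ScissorsTransport
import Summits.KontsevichZagierPeriods.KontsevichZagierPeriods.Theorems.HoffmanRelationInKZ.Negative.NoStokesLocality
import Literature.NumberTheory.Transcendental.KZCalculusProofs

/-! Sketch for the crux idea `slab-conservativity` (strategist, crux stmt-KontsevichZagierPeriods-4259;
bears on birth's stub `stub_sectorDestabilisation` = route crux `DestabilisedScissors`, stmt-4257).
First-lemma signatures only; proofs are not claimed here. -/

noncomputable section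

namespace Summit.KontsevichZagierPeriods.KontsevichZagierPeriods.Cruxes.MzvScissorsSector.SlabConservativitySketch

open Literature.NumberTheory.Transcendental
open Summit.KontsevichZagierPeriods.KontsevichZagierPeriods.Theses.ScissorsAvatars (DestabilisedScissors MzvScissorsSector)
open Summit.KontsevichZagierPeriods.KontsevichZagierPeriods.Theses.ScissorsTransport (NewtonLeibnizElimination)

/-- Slab stabilisation on formal combinations: `[r] ↦ [r.slab 0] = [σ × [0,1], f ∘ init]`. -/
def slabMap0 : KZ.FormalRep →+ KZ.FormalRep :=
  FreeAbelianGroup.lift fun p => KZ.of (p.2.slab 0)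

/-- SLAB LIFT: the scissors sub-calculus is stable under `× [0,1]` (each of 1a / 1b / 2 lifts to an
instance of the same rule: product domains, `Φ × id`). Provable bookkeeping. -/
def SlabLift : Prop :=
  ∀ y ∈ AddSubgroup.closure (KZ.domainAddRel ∪ KZ.integrandAddRel ∪ KZ.changeOfVariablesRel),
    slabMap0 y ∈ AddSubgroup.closure (KZ.domainAddRel ∪ KZ.integrandAddRel ∪ KZ.changeOfVariablesRel)

/-- SLAB CONSERVATIVITY (the transferred crux `C⁺` of `DestabilisedScissors`): `× [0,1]` is
injective on scissors classes — a homogeneous `y` of dimension `d` whose slab is a scissors relation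
in dimension `d + 1` is already a scissors relation in dimension `d`. -/
def SlabConservativity : Prop :=
  ∀ (d : ℕ) (y : KZ.FormalRep),
    y ∈ AddSubgroup.closure (Set.range (fun r : KZ.IntegralRep d => KZ.of r)) →
    slabMap0 y ∈ AddSubgroup.closure (KZ.domainAddRel ∪ KZ.integrandAddRel ∪ KZ.changeOfVariablesRel) →
    y ∈ AddSubgroup.closure (KZ.domainAddRel ∪ KZ.integrandAddRel ∪ KZ.changeOfVariablesRel)

/-- FIRST LEMMA (graded telescoping; to be proved): Newton–Leibniz elimination (ScissorsTransport's
crux 2668: rule 3 ∈ ⟨1a, 1b, 2, slabs⟩) + slab lift + slab conservativity ⇒ `DestabilisedScissors`.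
Ingredients in the tree: `C12` is graded by dimension (`HoffmanRelationInKZ.Negative.dimProj_mem_noStokesDim`),
`of_slab_sub_of_mem_newtonLeibnizRel`, slabs at level `j` ≡ level `0` by a translation (rule 2). -/
theorem destabilisedScissors_of_slabConservativity :
    NewtonLeibnizElimination → SlabLift → SlabConservativity → DestabilisedScissors := by
  sorry

/-- Converse direction (to be proved; shows the transfer is EXACT modulo 2668 + slab lift):
`DestabilisedScissors → SlabConservativity` (a `y` with `slab y ∈ C12` is a relation of one
dimension: `y ≡ slab y` by one Newton–Leibniz move per generator). -/
theorem slabConservativity_of_destabilisedScissors :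
    DestabilisedScissors → SlabConservativity := by
  sorry

end Summit.KontsevichZagierPeriods.KontsevichZagierPeriods.Cruxes.MzvScissorsSector.SlabConservativitySketch
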